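import Literature.MathematicalPhysics.KineticTheory.HardSphereDLRConsistency
import Literature.Analysis.FunctionSpaces.PoissonFiniteIntensitySeries
import HarnessLib

/-!
# The two DLR formalisations of the hard-sphere gas agree (general dimension); uniqueness at small activity

(topic MathematicalPhysics/KineticTheory; theorems only, no new definitions, no named facts; the
general-dimension port of Part II of `StatisticalMechanics/DiluteHardSphereGasProofs.lean`, of
`StatisticalMechanics/LowActivityHardSphereGibbsUniqueness.lean` and of the Janossy-ratio lemmas of
Part IV there — sixth file of the general-`d` port needed for `HardSphereGibbsLowDensityUniqueness`.)

For the intensity `ν_z = z · Leb ⊗ M_β(v - u) dv` on `ℝ^ι × ℝ^ι` and a hard-core boundary condition, the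
Poisson-form specification `HardSphereDLR.hsLocalSpec σ ν_z Λ η` and the series specification
`Literature.Analysis.FluidPDE.gibbsSpec σ z β u Λ η` coincide (Janossy formula), so the DLR classes
`HardSphereDLR.IsHsLocalGibbs σ ν_z` and `Literature.Analysis.FluidPDE.IsHardSphereGibbs σ z β u` coincide, and the
general-dimension uniqueness theorem `IsHsLocalGibbs.unique_of_small_activity` (Michelen–Perkins 2021)
gives **uniqueness of the hard-sphere Gibbs state at small activity in every dimension**:
`2 · z (2σ)^{#ι} < 1` (`unique_of_isHardSphereGibbs_of_small_activity`).

## References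

* D. Ruelle, *Statistical Mechanics: Rigorous Results*, Benjamin 1969, §1.2.1 (2.9)–(2.12), §4.2. [Ruelle1969]
* M. Michelen, W. Perkins, arXiv:2109.01094, Thm 3 and Thm 25. [MichelenPerkins2021]
* G. Last, M. Penrose, *Lectures on the Poisson Process*, CUP 2017, Prop. 3.5. [LastPenrose2017]
* H.-O. Georgii, *Gibbs Measures and Phase Transitions*, 2011, Def. 1.23. [Georgii2011]
-/

noncomputable section

open MeasureTheory ProbabilityTheory Set Filter Function
open scoped ENNReal NNReal Topology

namespace Literature.MathematicalPhysics.KineticTheory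

namespace HardSphereDLR

open Literature.Analysis.FluidPDE (IsHardCore isHardCore_empty HardCoreIn superposeIn gibbsWeight gibbsSpec
  IsHardSphereGibbs maxwellPhaseMeasure)
open Literature.Analysis.FunctionSpaces
open Literature.MathematicalPhysics.StatisticalMechanics (window mem_window measurableSet_window window_mono)

variable {ι : Type*} [Fintype ι]

/-! ### Lebesgue measure on `ℝ^ι`: balls and hyperplanes -/

/-- A ball of radius `σ` in `ℝ^ι` has volume at most `(2σ)^{#ι}` (it lies in a cube of side `2σ`). [folklore] -/
theorem volume_ball_le (a : EuclideanSpace ℝ ι) (σ : ℝ) :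
    volume (Metric.ball a σ) ≤ ENNReal.ofReal (2 * σ) ^ Fintype.card ι := by
  have hsub : Metric.ball a σ ⊆ (WithLp.ofLp : EuclideanSpace ℝ ι → ι → ℝ) ⁻¹'
      Icc (fun i => a i - σ) (fun i => a i + σ) := by
    intro q hq
    rw [Metric.mem_ball, dist_eq_norm] at hq
    simp only [mem_preimage, mem_Icc, Pi.le_def]
    have hi : ∀ i, |q i - a i| < σ := fun i =>
      lt_of_le_of_lt (by simpa using PiLp.norm_apply_le (q - a) i) hq
    exact ⟨fun i => by have := (abs_lt.1 (hi i)).1; change a i - σ ≤ q i; linarith,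
      fun i => by have := (abs_lt.1 (hi i)).2; change q i ≤ a i + σ; linarith⟩
  calc volume (Metric.ball a σ) ≤ volume ((WithLp.ofLp : EuclideanSpace ℝ ι → ι → ℝ) ⁻¹'
        Icc (fun i => a i - σ) (fun i => a i + σ)) := measure_mono hsub
    _ = volume (Icc (fun i : ι => a i - σ) (fun i => a i + σ)) :=
        (PiLp.volume_preserving_ofLp ι).measure_preimage measurableSet_Icc.nullMeasurableSet
    _ = ENNReal.ofReal (2 * σ) ^ Fintype.card ι := by
        rw [Real.volume_Icc_pi]
        simp only [add_sub_sub_cancel, Finset.prod_const, Finset.card_univ]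
        rw [← two_mul]


/-! ### The intensity `z · Leb ⊗ M` -/

/-- Restricting `z · Leb ⊗ M` to the window `Λ × ℝ^ι` gives `z · (Leb|_Λ ⊗ M)`. [folklore] -/
theorem restrict_window_smul_prod (z : ℝ) (M : Measure (EuclideanSpace ℝ ι)) [SFinite M] (Λ : Set (EuclideanSpace ℝ ι)) :
    (((Real.toNNReal z) • ((volume : Measure (EuclideanSpace ℝ ι)).prod M)).restrict (window Λ)) =
      (Real.toNNReal z) • (((volume : Measure (EuclideanSpace ℝ ι)).restrict Λ).prod M) := by
  rw [Measure.restrict_smul, Literature.MathematicalPhysics.StatisticalMechanics.window, ← Measure.restrict_prod_eq_prod_univ]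

/-- `Leb|_Λ ⊗ M` is finite for a bounded window and a finite mark law. [folklore] -/
theorem isFiniteMeasure_restrict_prod {Λ : Set (EuclideanSpace ℝ ι)} (hΛ : Bornology.IsBounded Λ) (M : Measure (EuclideanSpace ℝ ι))
    [IsFiniteMeasure M] : IsFiniteMeasure (((volume : Measure (EuclideanSpace ℝ ι)).restrict Λ).prod M) := by
  haveI : IsFiniteMeasure ((volume : Measure (EuclideanSpace ℝ ι)).restrict Λ) := ⟨by
    rw [Measure.restrict_apply_univ]; exact hΛ.measure_lt_top⟩
  infer_instance

/-- `z · (Leb ⊗ M)` has no atoms (`ι` nonempty). [folklore] -/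
theorem smul_prod_singleton [Nonempty ι] (z : ℝ) (M : Measure (EuclideanSpace ℝ ι)) [SFinite M]
    (x : EuclideanSpace ℝ ι × EuclideanSpace ℝ ι) :
    ((Real.toNNReal z) • ((volume : Measure (EuclideanSpace ℝ ι)).prod M)) {x} = 0 := by
  rw [Measure.smul_apply, ← singleton_prod_singleton, Measure.prod_prod, measure_singleton, zero_mul, smul_zero]

/-- `z · (Leb ⊗ M)` charges no coordinate hyperplane `{q_{i₀} = t}`. [folklore] -/
theorem smul_prod_setOf_fst_apply (i₀ : ι) (z : ℝ) (M : Measure (EuclideanSpace ℝ ι)) [SFinite M] (t : ℝ) :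
    ((Real.toNNReal z) • ((volume : Measure (EuclideanSpace ℝ ι)).prod M))
      {y : EuclideanSpace ℝ ι × EuclideanSpace ℝ ι | y.1 i₀ = t} = 0 := by
  have h : {y : EuclideanSpace ℝ ι × EuclideanSpace ℝ ι | y.1 i₀ = t} =
      {q : EuclideanSpace ℝ ι | q i₀ = t} ×ˢ (univ : Set (EuclideanSpace ℝ ι)) := by
    ext y; simp
  -- the coordinate hyperplane `{q_{i₀} = t}` is Lebesgue null (also `Literature.Analysis.PDE.volume_setOf_apply_eq`)
  have hnull : volume {q : EuclideanSpace ℝ ι | q i₀ = t} = 0 := by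
    have hset : {q : EuclideanSpace ℝ ι | q i₀ = t} = (WithLp.ofLp : EuclideanSpace ℝ ι → ι → ℝ) ⁻¹' {f | f i₀ = t} := rfl
    rw [hset, (PiLp.volume_preserving_ofLp ι).measure_preimage
      ((measurableSet_eq_fun (measurable_pi_apply i₀) measurable_const).nullMeasurableSet), MeasureTheory.volume_pi]
    exact Measure.pi_hyperplane (fun _ : ι => (volume : Measure ℝ)) i₀ t
  rw [h, Measure.smul_apply, Measure.prod_prod, hnull]
  simp

/-- `z · (Leb ⊗ M)` of a window `A × ℝ^ι` is `z |A| M(ℝ^ι)`. [folklore] -/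
theorem smul_prod_window (z : ℝ) (M : Measure (EuclideanSpace ℝ ι)) [SFinite M] (A : Set (EuclideanSpace ℝ ι)) :
    ((Real.toNNReal z) • ((volume : Measure (EuclideanSpace ℝ ι)).prod M)) (window A) =
      ENNReal.ofReal z * (volume A * M univ) := by
  rw [Measure.smul_apply, Literature.MathematicalPhysics.StatisticalMechanics.window, Measure.prod_prod]
  rfl

/-! ### Gluing a tuple: `superposeIn` is `glue ∘ ofFn`; the two hard-core events -/

omit [Fintype ι] in
/-- `superposeIn Λ x η = glue Λ η {x₁,…,x_k}`. [folklore] -/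
theorem superposeIn_eq_glue_ofFn (Λ : Set (EuclideanSpace ℝ ι)) {k : ℕ} (x : Fin k → EuclideanSpace ℝ ι × EuclideanSpace ℝ ι)
    (η : PointConfig (EuclideanSpace ℝ ι × EuclideanSpace ℝ ι)) :
    superposeIn Λ x η = glue Λ η (PointConfig.ofFn x) := by
  refine PointConfig.ext fun p => ?_
  change p ∈ (Set.range x ∩ Prod.fst ⁻¹' Λ) ∪ ((η : Set (EuclideanSpace ℝ ι × EuclideanSpace ℝ ι)) ∩ Prod.fst ⁻¹' Λᶜ) ↔
    p ∈ ((PointConfig.ofFn x).restrict (window Λ) ∪ η.restrict (window Λ)ᶜ).carrier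
  simp [PointConfig.carrier_restrict, Literature.MathematicalPhysics.StatisticalMechanics.window]

/-- For a hard-core boundary condition, the hard core IN the window of the glued configuration is
the hard core of the whole glued configuration. [folklore] -/
theorem hardCoreIn_glue_iff {σ : ℝ} {Λ : Set (EuclideanSpace ℝ ι)} {η : PointConfig (EuclideanSpace ℝ ι × EuclideanSpace ℝ ι)}
    (hη : IsHardCore σ η) (ξ : PointConfig (EuclideanSpace ℝ ι × EuclideanSpace ℝ ι)) :
    HardCoreIn σ Λ (glue Λ η ξ) ↔ IsHardCore σ (glue Λ η ξ) := by
  constructor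
  · intro h p hp q hq hpq
    by_cases hcase : p.1 ∈ Λ ∨ q.1 ∈ Λ
    · exact h p hp q hq hpq hcase
    · simp only [not_or] at hcase
      have hp' : p ∈ η := by
        rcases hp with hp | hp
        · exact absurd (mem_window.1 hp.2) hcase.1
        · exact hp.1
      have hq' : q ∈ η := by
        rcases hq with hq | hq
        · exact absurd (mem_window.1 hq.2) hcase.2
        · exact hq.1
      exact hη p hp' q hq' hpq
  · intro h p hp q hq hpq _
    exact h p hp q hq hpq

/-- The integrand of `gibbsWeight` in the glued form (hard-core boundary condition). [folklore] -/
theorem indicator_superposeIn_eq {σ : ℝ} {Λ : Set (EuclideanSpace ℝ ι)} {η : PointConfig (EuclideanSpace ℝ ι × EuclideanSpace ℝ ι)}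
    (hη : IsHardCore σ η) (A : Set (PointConfig (EuclideanSpace ℝ ι × EuclideanSpace ℝ ι))) {k : ℕ}
    (x : Fin k → EuclideanSpace ℝ ι × EuclideanSpace ℝ ι) :
    (A ∩ {X | HardCoreIn σ Λ X}).indicator (1 : PointConfig (EuclideanSpace ℝ ι × EuclideanSpace ℝ ι) → ℝ≥0∞) (superposeIn Λ x η) =
      (A ∩ hardCoreSet σ).indicator 1 (glue Λ η (PointConfig.ofFn x)) := by
  rw [superposeIn_eq_glue_ofFn]
  by_cases hA : glue Λ η (PointConfig.ofFn x) ∈ A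
  · by_cases hH : IsHardCore σ (glue Λ η (PointConfig.ofFn x))
    · rw [indicator_of_mem (show glue Λ η (PointConfig.ofFn x) ∈ A ∩ {X | HardCoreIn σ Λ X} from
          ⟨hA, (hardCoreIn_glue_iff hη _).2 hH⟩),
        indicator_of_mem (show glue Λ η (PointConfig.ofFn x) ∈ A ∩ hardCoreSet σ from ⟨hA, hH⟩)]
    · rw [indicator_of_notMem fun h => hH ((hardCoreIn_glue_iff hη _).1 h.2),
        indicator_of_notMem fun h => hH h.2]
  · rw [indicator_of_notMem fun h => hA h.1, indicator_of_notMem fun h => hA h.1]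

/-! ### The window law in Janossy form; the specifications agree -/

section Bridge

variable {z β : ℝ}

/-- **Janossy form of the glued window law, general marks**: for `ν = z · Leb ⊗ M` with a probability
mark law `M`, a bounded measurable window `Λ`, a boundary condition `η` and a measurable event `S`,
`P_{ν|Λ}(glue_η⁻¹ S) = e^{-z|Λ|} ∑ₖ (k!)⁻¹ zᵏ ∫ 𝟙_S(glue_η {x}) d(Leb|_Λ ⊗ M)^{⊗k}`.
[cite: LastPenrose2017, Prop. 3.5] -/
theorem poissonLaw_glue_preimage_eq_tsum' [Nonempty ι] (hz : 0 ≤ z) (M : Measure (EuclideanSpace ℝ ι)) [IsProbabilityMeasure M]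
    {Λ : Set (EuclideanSpace ℝ ι)} (hΛ : MeasurableSet Λ) (hb : Bornology.IsBounded Λ)
    (η : PointConfig (EuclideanSpace ℝ ι × EuclideanSpace ℝ ι))
    {S : Set (PointConfig (EuclideanSpace ℝ ι × EuclideanSpace ℝ ι))} (hS : MeasurableSet S) :
    poissonLaw ((Real.toNNReal z) • (((volume : Measure (EuclideanSpace ℝ ι)).restrict Λ).prod M)) (glue Λ η ⁻¹' S) =
      ENNReal.ofReal (Real.exp (-(z * (volume Λ).toReal))) *
        ∑' k : ℕ, ((k.factorial : ℝ≥0∞))⁻¹ * (ENNReal.ofReal z ^ k *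
          ∫⁻ x, S.indicator 1 (glue Λ η (PointConfig.ofFn x))
            ∂(Measure.pi fun _ : Fin k => ((volume : Measure (EuclideanSpace ℝ ι)).restrict Λ).prod M)) := by
  haveI : IsFiniteMeasure (((volume : Measure (EuclideanSpace ℝ ι)).restrict Λ).prod M) := isFiniteMeasure_restrict_prod hb _
  set π : Measure (EuclideanSpace ℝ ι × EuclideanSpace ℝ ι) := ((volume : Measure (EuclideanSpace ℝ ι)).restrict Λ).prod M with hπ
  set m : Measure (EuclideanSpace ℝ ι × EuclideanSpace ℝ ι) := (Real.toNNReal z) • π with hm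
  haveI : IsFiniteMeasure m := by rw [hm]; infer_instance
  have h0 : ∀ x, m {x} = 0 := fun x => by
    have h1 : ((volume : Measure (EuclideanSpace ℝ ι)).restrict Λ) {x.1} = 0 :=
      nonpos_iff_eq_zero.1 ((Measure.le_iff'.1 Measure.restrict_le_self {x.1}).trans_eq (measure_singleton x.1))
    rw [hm, Measure.smul_apply, hπ, ← singleton_prod_singleton, Measure.prod_prod, h1, zero_mul, smul_zero]
  have hP : IsPoissonPointProcess m (poissonLaw m) := isPoissonPointProcess_poissonLaw m h0
  have hg : Measurable (glue Λ η) := measurable_glue hΛ η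
  -- `(c π)^{⊗k} = c^k π^{⊗k}`
  have pi_const_smul : ∀ (k : ℕ) (c : ℝ≥0), Measure.pi (fun _ : Fin k => c • π) =
      ((c : ℝ≥0∞) ^ k) • Measure.pi (fun _ : Fin k => π) := fun k c => by
    refine (Measure.pi_eq fun s _ => ?_)
    rw [Measure.smul_apply, smul_eq_mul, Measure.pi_pi]
    simp only [Measure.smul_apply, ENNReal.smul_def, smul_eq_mul]
    rw [Finset.prod_mul_distrib, Finset.prod_const, Finset.card_univ, Fintype.card_fin]
  rw [← lintegral_indicator_one (hS.preimage hg),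
    hP.lintegral_eq_tsum_lintegral_ofFn (F := fun c => (glue Λ η ⁻¹' S).indicator 1 c)
      (measurable_one.indicator (hS.preimage hg))]
  have huniv : m univ = ENNReal.ofReal (z * (volume Λ).toReal) := by
    rw [hm, Measure.smul_apply, hπ, ← univ_prod_univ, Measure.prod_prod, Measure.restrict_apply_univ,
      measure_univ, mul_one, ENNReal.smul_def, smul_eq_mul, ENNReal.ofReal_mul hz,
      ENNReal.ofReal_toReal hb.measure_lt_top.ne]
    rfl
  rw [huniv, ENNReal.toReal_ofReal (mul_nonneg hz ENNReal.toReal_nonneg), ← ENNReal.tsum_mul_left]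
  refine tsum_congr fun k => ?_
  rw [ENNReal.ofReal_div_of_pos (by exact_mod_cast k.factorial_pos), ENNReal.ofReal_natCast, hm,
    pi_const_smul, lintegral_smul_measure, ENNReal.div_eq_inv_mul]
  have hind : ∀ x : Fin k → EuclideanSpace ℝ ι × EuclideanSpace ℝ ι,
      (glue Λ η ⁻¹' S).indicator (1 : PointConfig (EuclideanSpace ℝ ι × EuclideanSpace ℝ ι) → ℝ≥0∞) (PointConfig.ofFn x) =
        S.indicator 1 (glue Λ η (PointConfig.ofFn x)) := fun x =>
    indicator_comp_right (glue Λ η) (g := (1 : PointConfig (EuclideanSpace ℝ ι × EuclideanSpace ℝ ι) → ℝ≥0∞))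
  simp_rw [hind]
  rw [smul_eq_mul, show ((Real.toNNReal z : ℝ≥0∞)) ^ k = ENNReal.ofReal z ^ k from rfl]
  ring


/-- **The two finite-volume hard-sphere specifications agree** for the intensity `ν = z · Leb ⊗ M_β(v-u)dv`
and a hard-core boundary condition: `hsLocalSpec σ ν Λ η A = FluidPDE.gibbsSpec σ z β u Λ η A`
(bounded measurable `Λ`, measurable `A`). [cite: Ruelle1969, §1.2.1 (2.9)–(2.12)] -/
theorem hsLocalSpec_eq_gibbsSpec [Nonempty ι] (u : EuclideanSpace ℝ ι) (hz : 0 ≤ z) (hβ : 0 < β) {σ : ℝ} {Λ : Set (EuclideanSpace ℝ ι)}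
    (hΛ : MeasurableSet Λ) (hb : Bornology.IsBounded Λ) {η : PointConfig (EuclideanSpace ℝ ι × EuclideanSpace ℝ ι)}
    (hη : IsHardCore σ η) {A : Set (PointConfig (EuclideanSpace ℝ ι × EuclideanSpace ℝ ι))} (hA : MeasurableSet A) :
    hsLocalSpec σ ((Real.toNNReal z) • ((volume : Measure (EuclideanSpace ℝ ι)).prod
        ((volume : Measure (EuclideanSpace ℝ ι)).withDensity fun v => ENNReal.ofReal (maxwellianBeta β (v - u))))) Λ η A =
      gibbsSpec σ z β u Λ η A := by
  haveI := isProbabilityMeasure_withDensity_maxwellianBeta (d := ι) hβ u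
  set M : Measure (EuclideanSpace ℝ ι) := (volume : Measure (EuclideanSpace ℝ ι)).withDensity
    fun v => ENNReal.ofReal (maxwellianBeta β (v - u)) with hM
  have hH := measurableSet_hardCoreSet (d := ι) σ
  have hmax : maxwellPhaseMeasure β u Λ = ((volume : Measure (EuclideanSpace ℝ ι)).restrict Λ).prod M := rfl
  -- the series `W S = ∑ₖ zᵏ/k! ∫ 𝟙_S(glue {x}) dπ^{⊗k}`
  set W : Set (PointConfig (EuclideanSpace ℝ ι × EuclideanSpace ℝ ι)) → ℝ≥0∞ := fun S => ∑' k : ℕ, ENNReal.ofReal (z ^ k / k.factorial) *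
    ∫⁻ x, S.indicator 1 (glue Λ η (PointConfig.ofFn x))
      ∂(Measure.pi fun _ : Fin k => ((volume : Measure (EuclideanSpace ℝ ι)).restrict Λ).prod M) with hW
  have hweight : ∀ S : Set (PointConfig (EuclideanSpace ℝ ι × EuclideanSpace ℝ ι)),
      gibbsWeight σ z β u Λ η S = W (S ∩ hardCoreSet σ) := fun S => by
    simp only [hW, gibbsWeight, hmax]
    refine tsum_congr fun k => ?_
    congr 1
    refine lintegral_congr fun x => ?_
    exact indicator_superposeIn_eq hη S x
  set E : ℝ≥0∞ := ENNReal.ofReal (Real.exp (-(z * (volume Λ).toReal))) with hE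
  have hE0 : E ≠ 0 := (ENNReal.ofReal_pos.2 (Real.exp_pos _)).ne'
  have hEtop : E ≠ ∞ := ENNReal.ofReal_ne_top
  have hjan : ∀ {S : Set (PointConfig (EuclideanSpace ℝ ι × EuclideanSpace ℝ ι))}, MeasurableSet S →
      poissonLaw ((Real.toNNReal z) • (((volume : Measure (EuclideanSpace ℝ ι)).restrict Λ).prod M)) (glue Λ η ⁻¹' S) =
        E * W S := fun {S} hS => by
    rw [poissonLaw_glue_preimage_eq_tsum' hz M hΛ hb η hS, hE, hW]
    congr 1
    refine tsum_congr fun k => ?_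
    rw [← mul_assoc]
    congr 1
    rw [ENNReal.ofReal_div_of_pos (by exact_mod_cast k.factorial_pos), ENNReal.ofReal_pow hz,
      ENNReal.ofReal_natCast, div_eq_mul_inv, mul_comm]
  rw [hsLocalSpec_apply_eq σ _ hΛ η hA, restrict_window_smul_prod, hjan hH, hjan (hA.inter hH),
    Literature.Analysis.FluidPDE.gibbsSpec, hweight, hweight, univ_inter, ENNReal.mul_inv (Or.inl hE0) (Or.inl hEtop),
    ENNReal.div_eq_inv_mul]
  calc E⁻¹ * (W (hardCoreSet σ))⁻¹ * (E * W (A ∩ hardCoreSet σ))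
      = (E⁻¹ * E) * ((W (hardCoreSet σ))⁻¹ * W (A ∩ hardCoreSet σ)) := by ring
    _ = (W (hardCoreSet σ))⁻¹ * W (A ∩ hardCoreSet σ) := by rw [ENNReal.inv_mul_cancel hE0 hEtop, one_mul]

/-- **DLR states for `hsLocalSpec` are DLR states for `FluidPDE.gibbsSpec`.** [cite: Georgii2011, Def. 1.23] -/
theorem isHardSphereGibbs_of_isHsLocalGibbs [Nonempty ι] (u : EuclideanSpace ℝ ι) (hz : 0 ≤ z) (hβ : 0 < β) {σ : ℝ}
    {μ : Measure (PointConfig (EuclideanSpace ℝ ι × EuclideanSpace ℝ ι))}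
    (hμ : IsHsLocalGibbs σ ((Real.toNNReal z) • ((volume : Measure (EuclideanSpace ℝ ι)).prod
        ((volume : Measure (EuclideanSpace ℝ ι)).withDensity fun v => ENNReal.ofReal (maxwellianBeta β (v - u))))) μ) :
    IsHardSphereGibbs σ z β u μ := by
  refine ⟨hμ.isProbabilityMeasure, fun Λ hΛ hb A hA => ?_⟩
  rw [← hμ.lintegral_hsLocalSpec hΛ hb hA]
  refine lintegral_congr_ae (hμ.ae_isHardCore.mono fun η hη => ?_)
  exact hsLocalSpec_eq_gibbsSpec u hz hβ hΛ hb hη hA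

/-! ### A `FluidPDE` hard-sphere Gibbs state is carried by hard-core configurations; the converse bridge -/

/-- If a configuration satisfies the hard core IN the window `Λ`, its restriction to `Λ × ℝ^ι` is a hard-core
configuration. [folklore] -/
theorem isHardCore_restrict_window_of_hardCoreIn {σ : ℝ} {Λ : Set (EuclideanSpace ℝ ι)}
    {X : PointConfig (EuclideanSpace ℝ ι × EuclideanSpace ℝ ι)} (hX : HardCoreIn σ Λ X) : IsHardCore σ (X.restrict (window Λ)) := by
  intro p hp q hq hpq
  have hp' : p ∈ X.carrier ∩ window Λ := hp
  have hq' : q ∈ X.carrier ∩ window Λ := hq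
  exact hX p hp'.1 q hq'.1 hpq (Or.inl (mem_window.1 hp'.2))

/-- The event "the restriction to `Λ × ℝ^ι` violates the hard core" is measurable. [folklore] -/
theorem measurableSet_restrict_window_not_mem_hardCoreSet (σ : ℝ) {Λ : Set (EuclideanSpace ℝ ι)} (hΛ : MeasurableSet Λ) :
    MeasurableSet {c : PointConfig (EuclideanSpace ℝ ι × EuclideanSpace ℝ ι) | c.restrict (window Λ) ∉ hardCoreSet σ} :=
  (measurableSet_hardCoreSet σ).compl.preimage (PointConfig.measurable_restrict (measurableSet_window hΛ))

/-- The series specification of the window `Λ` gives no weight to configurations whose restriction to `Λ × ℝ^ι`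
violates the hard core. [folklore] -/
theorem gibbsWeight_restrict_window_not_mem_hardCoreSet (σ z β : ℝ) (u : EuclideanSpace ℝ ι) (Λ : Set (EuclideanSpace ℝ ι))
    (Y : PointConfig (EuclideanSpace ℝ ι × EuclideanSpace ℝ ι)) :
    gibbsWeight σ z β u Λ Y {c : PointConfig (EuclideanSpace ℝ ι × EuclideanSpace ℝ ι) | c.restrict (window Λ) ∉ hardCoreSet σ} = 0 := by
  unfold gibbsWeight
  refine ENNReal.tsum_eq_zero.2 fun k => ?_
  have hzero : ∀ x : Fin k → EuclideanSpace ℝ ι × EuclideanSpace ℝ ι,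
      ({c : PointConfig (EuclideanSpace ℝ ι × EuclideanSpace ℝ ι) | c.restrict (window Λ) ∉ hardCoreSet σ} ∩
        {X | HardCoreIn σ Λ X}).indicator
        (1 : PointConfig (EuclideanSpace ℝ ι × EuclideanSpace ℝ ι) → ℝ≥0∞) (superposeIn Λ x Y) = 0 := fun x => by
    refine indicator_of_notMem (fun h => h.1 ?_) _
    exact isHardCore_restrict_window_of_hardCoreIn h.2
  simp_rw [hzero]
  rw [lintegral_zero, mul_zero]

variable {σ : ℝ} {u : EuclideanSpace ℝ ι} {μ : Measure (PointConfig (EuclideanSpace ℝ ι × EuclideanSpace ℝ ι))}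

/-- Under a hard-sphere Gibbs state, almost surely the restriction to every bounded measurable window is a hard-core
configuration. [folklore] -/
theorem measure_restrict_window_not_mem_hardCoreSet_of_isHardSphereGibbs (h : IsHardSphereGibbs σ z β u μ)
    {Λ : Set (EuclideanSpace ℝ ι)} (hΛ : MeasurableSet Λ) (hb : Bornology.IsBounded Λ) :
    μ {c : PointConfig (EuclideanSpace ℝ ι × EuclideanSpace ℝ ι) | c.restrict (window Λ) ∉ hardCoreSet σ} = 0 := by
  rw [h.2 Λ hΛ hb _ (measurableSet_restrict_window_not_mem_hardCoreSet σ hΛ)]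
  have hspec : ∀ Y : PointConfig (EuclideanSpace ℝ ι × EuclideanSpace ℝ ι),
      gibbsSpec σ z β u Λ Y {c : PointConfig (EuclideanSpace ℝ ι × EuclideanSpace ℝ ι) | c.restrict (window Λ) ∉ hardCoreSet σ} = 0 :=
    fun Y => by
      rw [Literature.Analysis.FluidPDE.gibbsSpec, gibbsWeight_restrict_window_not_mem_hardCoreSet, ENNReal.zero_div]
  simp_rw [hspec]
  rw [lintegral_zero]

/-- **A hard-sphere Gibbs state (series DLR class) is carried by hard-core configurations.** [folklore] -/
theorem ae_isHardCore_of_isHardSphereGibbs (h : IsHardSphereGibbs σ z β u μ) : ∀ᵐ c ∂μ, IsHardCore σ c := by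
  have hall : ∀ᵐ c ∂μ, ∀ n : ℕ, c.restrict (window (Metric.ball (0 : EuclideanSpace ℝ ι) n)) ∈ hardCoreSet σ := by
    refine ae_all_iff.2 fun n => ?_
    rw [ae_iff]
    simpa only [not_not] using
      measure_restrict_window_not_mem_hardCoreSet_of_isHardSphereGibbs h Metric.isOpen_ball.measurableSet Metric.isBounded_ball
  filter_upwards [hall] with c hc
  intro p hp q hq hpq
  obtain ⟨n, hn⟩ := exists_nat_gt (max ‖p.1‖ ‖q.1‖)
  have hpn : p ∈ c.restrict (window (Metric.ball (0 : EuclideanSpace ℝ ι) n)) :=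
    ⟨hp, mem_window.2 (mem_ball_zero_iff.2 ((le_max_left _ _).trans_lt hn))⟩
  have hqn : q ∈ c.restrict (window (Metric.ball (0 : EuclideanSpace ℝ ι) n)) :=
    ⟨hq, mem_window.2 (mem_ball_zero_iff.2 ((le_max_right _ _).trans_lt hn))⟩
  exact hc n p hpn q hqn hpq

/-- **DLR states for `FluidPDE.gibbsSpec` are DLR states for `hsLocalSpec`.** [cite: Georgii2011, Def. 1.23] -/
theorem isHsLocalGibbs_of_isHardSphereGibbs [Nonempty ι] (hz : 0 ≤ z) (hβ : 0 < β) (hμ : IsHardSphereGibbs σ z β u μ) :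
    IsHsLocalGibbs σ ((Real.toNNReal z) • ((volume : Measure (EuclideanSpace ℝ ι)).prod
      ((volume : Measure (EuclideanSpace ℝ ι)).withDensity fun v => ENNReal.ofReal (maxwellianBeta β (v - u))))) μ := by
  refine ⟨hμ.1, fun Λ hΛ hb A hA => ?_⟩
  rw [hμ.2 Λ hΛ hb A hA]
  refine lintegral_congr_ae ((ae_isHardCore_of_isHardSphereGibbs hμ).mono fun η hη => ?_)
  exact hsLocalSpec_eq_gibbsSpec u hz hβ hΛ hb hη hA

/-- **The two DLR formalisations define the same class of states** (`0 ≤ z`, `0 < β`). [cite: Georgii2011, Def. 1.23] -/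
theorem isHardSphereGibbs_iff_isHsLocalGibbs [Nonempty ι] (u : EuclideanSpace ℝ ι) (hz : 0 ≤ z) (hβ : 0 < β) {σ : ℝ}
    {μ : Measure (PointConfig (EuclideanSpace ℝ ι × EuclideanSpace ℝ ι))} :
    IsHardSphereGibbs σ z β u μ ↔ IsHsLocalGibbs σ ((Real.toNNReal z) • ((volume : Measure (EuclideanSpace ℝ ι)).prod
      ((volume : Measure (EuclideanSpace ℝ ι)).withDensity fun v => ENNReal.ofReal (maxwellianBeta β (v - u))))) μ :=
  ⟨isHsLocalGibbs_of_isHardSphereGibbs hz hβ, isHardSphereGibbs_of_isHsLocalGibbs u hz hβ⟩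

/-! ### Uniqueness at small activity, every dimension -/

/-- The hypotheses of the uniqueness theorem for `ν = z · Leb ⊗ M_β(v-u)dv` at `2 z (2σ)^{#ι} < 1`: `ν` is atomless,
charges no coordinate hyperplane, gives mass `≤ z (2σ)^{#ι}` to every ball window, and finite mass to the
windows of balls. [folklore] -/
theorem smul_prod_uniqueness_hypotheses [Nonempty ι] (i₀ : ι) (hσ : 0 < σ) (hz : 0 ≤ z) (hβ : 0 < β) (u : EuclideanSpace ℝ ι) :
    let ν : Measure (EuclideanSpace ℝ ι × EuclideanSpace ℝ ι) := (Real.toNNReal z) • ((volume : Measure (EuclideanSpace ℝ ι)).prod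
      ((volume : Measure (EuclideanSpace ℝ ι)).withDensity fun v => ENNReal.ofReal (maxwellianBeta β (v - u))))
    (∀ x, ν {x} = 0) ∧ (∀ t : ℝ, ν {y : EuclideanSpace ℝ ι × EuclideanSpace ℝ ι | y.1 i₀ = t} = 0) ∧
      0 ≤ z * (2 * σ) ^ Fintype.card ι ∧
      (∀ a : EuclideanSpace ℝ ι, ν (window (Metric.ball a σ)) ≤ ENNReal.ofReal (z * (2 * σ) ^ Fintype.card ι)) ∧
      (∀ R : ℝ, ν (window (Metric.ball (0 : EuclideanSpace ℝ ι) R)) ≠ ∞) := by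
  haveI := isProbabilityMeasure_withDensity_maxwellianBeta (d := ι) hβ u
  set M : Measure (EuclideanSpace ℝ ι) := (volume : Measure (EuclideanSpace ℝ ι)).withDensity
    fun v => ENNReal.ofReal (maxwellianBeta β (v - u)) with hM
  refine ⟨smul_prod_singleton z M, smul_prod_setOf_fst_apply i₀ z M, by positivity, fun a => ?_, fun R => ?_⟩
  · rw [smul_prod_window, measure_univ, mul_one, ENNReal.ofReal_mul hz, ENNReal.ofReal_pow (by positivity)]
    gcongr
    exact volume_ball_le a σ
  · rw [smul_prod_window, measure_univ, mul_one]
    exact ENNReal.mul_ne_top ENNReal.ofReal_ne_top Metric.isBounded_ball.measure_lt_top.ne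

/-- **Uniqueness of the hard-sphere Gibbs state at small activity, every dimension** (DLR class
`IsHardSphereGibbs`): for `0 < σ`, `0 ≤ z` with `2 z (2σ)^{#ι} < 1`, `0 < β` and nonempty `ι`, two solutions of
the DLR equations `IsHardSphereGibbs σ z β u` on `ℝ^ι × ℝ^ι` coincide (Michelen–Perkins disagreement bound).
[cite: MichelenPerkins2021, Thm 3 and Thm 25] -/
theorem unique_of_isHardSphereGibbs_of_small_activity [Nonempty ι] (hσ : 0 < σ) (hz : 0 ≤ z)
    (hzσ : 2 * (z * (2 * σ) ^ Fintype.card ι) < 1) (hβ : 0 < β)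
    {μ μ' : Measure (PointConfig (EuclideanSpace ℝ ι × EuclideanSpace ℝ ι))}
    (hμ : IsHardSphereGibbs σ z β u μ) (hμ' : IsHardSphereGibbs σ z β u μ') : μ = μ' := by
  obtain ⟨h0, hm, hκ0, hκ, hfin⟩ := smul_prod_uniqueness_hypotheses (Classical.arbitrary ι) hσ hz hβ u
  haveI := isProbabilityMeasure_withDensity_maxwellianBeta (d := ι) hβ u
  exact IsHsLocalGibbs.unique_of_small_activity (Classical.arbitrary ι) _ hσ h0 hm hκ0 hκ hzσ hfin
    (isHsLocalGibbs_of_isHardSphereGibbs hz hβ hμ) (isHsLocalGibbs_of_isHardSphereGibbs hz hβ hμ')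

end Bridge

end HardSphereDLR

end Literature.MathematicalPhysics.KineticTheory
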